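import Mathlib

/-!
# Route FilamentSkeletonRss · crux `CoreGluing` (stmt-NavierStokesRegularity-15401) — line `Sketch`,
# stub `stub_accretionBudgetRigidity`: an exact steady tube neither accretes nor strips

Helper file (theorems only) for the skeleton of the crux `CoreGluing`. Along a filament with
tangential material speed `w = Φ'` (one stagnation point, `Φ → +∞` at both ends) the circulation
`κ(τ)` through the cross-sections of an exact steady tube obeys the one-dimensional budget
`κ'' − Φ' κ' = F`, `F` the net sideways vorticity flux. The lemma proved here is the *signed*
rigidity statement (idea card `zero-accretion-selection`): if `F ≥ 0` and `κ` is bounded, then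
`F ≡ 0` and `κ' ≡ 0`.

Proof. With the integrating factor, `ψ := κ' e^{−Φ}` satisfies `ψ' = F e^{−Φ} ≥ 0`, so `ψ` is
monotone on `ℝ`. If `ψ τ₁ > 0` for some `τ₁`, then for `τ ≥ τ₁` with `Φ τ ≥ 0` (eventually at `+∞`)
`κ' τ = ψ τ · e^{Φ τ} ≥ ψ τ₁ > 0`, so by the mean value inequality `κ` grows at least linearly,
contradicting `|κ| ≤ M`; hence `ψ ≤ 0`. The reflection `τ ↦ −τ` (which keeps `ψ ↦ −ψ(−·)` monotone
and uses `Φ → +∞` at `−∞`) gives `ψ ≥ 0`. So `ψ ≡ 0`, `κ' ≡ 0` (`e^{−Φ} ≠ 0`), and then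
`F = κ'' − Φ'·0 = (κ')' = 0`. Mathlib only.
-/

-- the summit and its single sub-problem share the name (CONVENTIONS §1), as in every Theorems file
set_option linter.dupNamespace false

namespace Summit.NavierStokesRegularity.NavierStokesRegularity.Theorems

open Set Filter MeasureTheory Topology

/-- Linear growth versus boundedness: there is no function with `|κ| ≤ M` on `ℝ` whose
derivative is eventually `≥ c > 0` at `+∞` (mean value inequality on `[T, T + (2M+1)/c]`).
(Adapted from the private helper of the sibling file `…AccretionBudgetZeroMean`.) -/
private theorem accretionRigidity_false_of_le_deriv {κ κ' : ℝ → ℝ} {M c : ℝ}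
    (hM : ∀ τ, |κ τ| ≤ M) (hκ : ∀ τ, HasDerivAt κ (κ' τ) τ) (hc : 0 < c)
    (h : ∀ᶠ τ in atTop, c ≤ κ' τ) : False := by
  obtain ⟨T, hT⟩ := eventually_atTop.1 h
  have hdiff : Differentiable ℝ κ := fun τ => (hκ τ).differentiableAt
  have hM0 : 0 ≤ M := (abs_nonneg _).trans (hM 0)
  have hTy : T ≤ T + (2 * M + 1) / c := by
    have : 0 ≤ (2 * M + 1) / c := div_nonneg (by linarith) hc.le
    linarith
  have key : c * (T + (2 * M + 1) / c - T) ≤ κ (T + (2 * M + 1) / c) - κ T :=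
    (convex_Ici T).mul_sub_le_image_sub_of_le_deriv hdiff.continuous.continuousOn
      hdiff.differentiableOn
      (fun x hx => by
        rw [interior_Ici] at hx
        rw [(hκ x).deriv]
        exact hT x (le_of_lt hx))
      T self_mem_Ici _ hTy hTy
  have h1 : c * (T + (2 * M + 1) / c - T) = 2 * M + 1 := by
    rw [add_sub_cancel_left, mul_div_cancel₀ _ hc.ne']
  have h2 := hM (T + (2 * M + 1) / c)
  have h3 := hM T
  rw [abs_le] at h2 h3
  linarith [h2.1, h2.2, h3.1, h3.2]

/-- If `κ' = ψ · e^{Φ}` with `κ` bounded, `Φ → +∞` along `atTop` and `ψ` monotone, then `ψ ≤ 0`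
everywhere: a positive value `ψ τ₁` would propagate to all `τ ≥ τ₁` and make `κ'` eventually
`≥ ψ τ₁ > 0`. -/
private theorem accretionRigidity_nonpos {κ ψ Φ : ℝ → ℝ} {M : ℝ}
    (hM : ∀ τ, |κ τ| ≤ M) (hκ : ∀ τ, HasDerivAt κ (ψ τ * Real.exp (Φ τ)) τ)
    (hΦ : Tendsto Φ atTop atTop) (hψ : Monotone ψ) (τ₁ : ℝ) : ψ τ₁ ≤ 0 := by
  refine not_lt.1 fun h => accretionRigidity_false_of_le_deriv hM hκ h ?_
  filter_upwards [eventually_ge_atTop τ₁, hΦ.eventually_ge_atTop 0] with τ h1 h2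
  have h3 : 1 ≤ Real.exp (Φ τ) := Real.one_le_exp h2
  have : ψ τ₁ * 1 ≤ ψ τ * Real.exp (Φ τ) :=
    mul_le_mul (hψ h1) h3 zero_le_one (h.le.trans (hψ h1))
  linarith

/-- The mirror statement along `atBot` (with `Φ → +∞` at `−∞`): `0 ≤ ψ` everywhere, by the
reflection `τ ↦ −τ`, under which `ψ ↦ −ψ(−·)` stays monotone. -/
private theorem accretionRigidity_nonneg {κ ψ Φ : ℝ → ℝ} {M : ℝ}
    (hM : ∀ τ, |κ τ| ≤ M) (hκ : ∀ τ, HasDerivAt κ (ψ τ * Real.exp (Φ τ)) τ)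
    (hΦ : Tendsto Φ atBot atTop) (hψ : Monotone ψ) (τ₁ : ℝ) : 0 ≤ ψ τ₁ := by
  have h := accretionRigidity_nonpos (κ := fun τ => κ (-τ)) (ψ := fun τ => -ψ (-τ))
    (Φ := fun τ => Φ (-τ)) (M := M) (fun τ => hM (-τ))
    (fun τ => ((hκ (-τ)).comp τ (hasDerivAt_neg τ)).congr_deriv (by ring))
    (hΦ.comp tendsto_neg_atTop_atBot) (fun a b hab => neg_le_neg (hψ (neg_le_neg hab))) (-τ₁)
  simp only [neg_neg, neg_nonpos] at h
  exact h

/-- **Accretion budget rigidity (signed form).** If `κ` is bounded and `C²`, `Φ` is `C¹` with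
`Φ → +∞` at both ends, `F ≥ 0` is continuous, and the circulation budget `κ'' − Φ' κ' = F` holds
on `ℝ`, then `F ≡ 0` and `κ' ≡ 0`: an exact steady tube neither accretes nor strips.
(Idea card `zero-accretion-selection`; route `FilamentSkeletonRss`, crux `CoreGluing`.) -/
theorem stub_accretionBudgetRigidity : ∀ (κ Φ F : ℝ → ℝ), (∃ M : ℝ, ∀ τ, |κ τ| ≤ M) → ContDiff ℝ 2 κ → ContDiff ℝ 1 Φ → Continuous F → Tendsto Φ atTop atTop → Tendsto Φ atBot atTop → (∀ τ, 0 ≤ F τ) → (∀ τ, iteratedDeriv 2 κ τ - deriv Φ τ * deriv κ τ = F τ) → (∀ τ, F τ = 0) ∧ ∀ τ, deriv κ τ = 0 := by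
  intro κ Φ F hM hκ hΦ _hF hΦtop hΦbot hF0 hODE
  obtain ⟨M, hM⟩ := hM
  -- first and second derivatives of `κ`, first derivative of `Φ`
  have hκ1 : ∀ τ, HasDerivAt κ (deriv κ τ) τ := fun τ =>
    ((hκ.differentiable (by simp)) τ).hasDerivAt
  have hκ2 : ∀ τ, HasDerivAt (deriv κ) (iteratedDeriv 2 κ τ) τ := fun τ => by
    rw [iteratedDeriv_succ, iteratedDeriv_one]
    exact (hκ.differentiable_deriv_two τ).hasDerivAt
  have hΦ1 : ∀ τ, HasDerivAt Φ (deriv Φ τ) τ := fun τ =>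
    ((hΦ.differentiable (by simp)) τ).hasDerivAt
  -- `ψ := κ' e^{-Φ}` has derivative `F e^{-Φ} ≥ 0` (integrating factor + the budget), so is monotone
  set ψ : ℝ → ℝ := fun τ => deriv κ τ * Real.exp (-Φ τ) with hψ_def
  have hψ : ∀ τ, HasDerivAt ψ (F τ * Real.exp (-Φ τ)) τ := fun τ => by
    refine ((hκ2 τ).mul (hΦ1 τ).fun_neg.exp).congr_deriv ?_
    rw [← hODE τ]
    ring
  have hψmono : Monotone ψ :=
    monotone_of_deriv_nonneg (fun τ => (hψ τ).differentiableAt) fun τ => by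
      rw [(hψ τ).deriv]
      exact mul_nonneg (hF0 τ) (Real.exp_nonneg _)
  -- `κ' = ψ e^{Φ}` with `κ` bounded and `Φ → +∞` at both ends: `ψ ≤ 0` and `ψ ≥ 0`
  have hκψ : ∀ τ, HasDerivAt κ (ψ τ * Real.exp (Φ τ)) τ := fun τ => by
    refine (hκ1 τ).congr_deriv ?_
    show deriv κ τ = deriv κ τ * Real.exp (-Φ τ) * Real.exp (Φ τ)
    rw [mul_assoc, ← Real.exp_add, neg_add_cancel, Real.exp_zero, mul_one]
  have hψ0 : ∀ τ, ψ τ = 0 := fun τ =>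
    le_antisymm (accretionRigidity_nonpos hM hκψ hΦtop hψmono τ)
      (accretionRigidity_nonneg hM hκψ hΦbot hψmono τ)
  -- hence `κ' ≡ 0`, and `F = κ'' − Φ'·0 = (κ')' = 0`
  have hκ0 : ∀ τ, deriv κ τ = 0 := fun τ => by
    rcases mul_eq_zero.1 (hψ0 τ) with h | h
    · exact h
    · exact absurd h (Real.exp_ne_zero _)
  have hκ0' : deriv κ = fun _ => (0 : ℝ) := funext hκ0
  refine ⟨fun τ => ?_, hκ0⟩
  rw [← hODE τ, hκ0 τ, mul_zero, sub_zero, iteratedDeriv_succ, iteratedDeriv_one, hκ0']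
  exact deriv_const τ 0

end Summit.NavierStokesRegularity.NavierStokesRegularity.Theorems
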